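import Literature.AlgebraicTopology.Homotopy.SphereConnectedCover
import Literature.AlgebraicTopology.Homotopy.SerreFibrationPreimages
import Literature.AlgebraicTopology.Homotopy.BasedMaps
import Literature.AlgebraicTopology.Homotopy.ZeroCellBasepoints
import Literature.AlgebraicTopology.SingularHomology.HurewiczTheoremProofs
import Literature.AlgebraicTopology.SingularHomology.HomologySpheresProofs
import HarnessLib

/-!
# `Sⁿ⟨n⟩` is `n`-connected: the boundary map of the cover is an isomorphism

Topic `Literature/AlgebraicTopology/Homotopy`. A. Hatcher, *Algebraic Topology* (2002), §4.3,
Example 4.72 (Whitehead towers, p. 410: the first stage `X₁ → X` over `X = Sⁿ` kills `πₙ`; in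
`… → πₙ(Sⁿ⟨n⟩) → πₙ(Sⁿ) →∂ πₙ₋₁(ΩPₙSⁿ) → πₙ₋₁(Sⁿ⟨n⟩) → …` the boundary map is the composite of
`ι_* : πₙ(Sⁿ) ≅ πₙ(PₙSⁿ)` and the boundary isomorphism of the path fibration, p. 408), with
Thm. 4.41 (the long exact sequence and its naturality under maps of fibrations, p. 377 / p. 406
"pullback fibration") and Thm. 4.32 (Hurewicz). We PROVE (no definitions besides two abbreviations
for restricted maps):

* `IsSerreFibration.delta_natural` — **naturality of the connecting map** under a fibrewise map
  `Φ : E → E'` over `g : B → B'` between Serre fibrations: `∂' (g_* β) = (Φ|F)_* (∂ β)`;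
* for the cover `SphereCover.proj n v : E n v → 𝕊ⁿ` (`SphereConnectedCover.lean`):
  `SphereCover.bijective_delta` — `∂ : πₙ(𝕊ⁿ, v) → πₙ₋₁(F, fib₀)` is bijective (`n = m + 2`);
  `SphereCover.pathConnectedSpace_E`, `subsingleton_homotopyGroup_E` (`πₖ(E) = 0`, `1 ≤ k ≤ n`),
  `simplyConnectedSpace_E` — **`Sⁿ⟨n⟩` is `n`-connected**;
  `SphereCover.isZero_singularHomology_E` — `Hᵢ(Sⁿ⟨n⟩; ℤ) = 0` for `0 < i ≤ n` (Hurewicz) and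
  `SphereCover.isZero_singularCohomology_E` — `Hⁱ(Sⁿ⟨n⟩; ℤ) = 0` for `1 ≤ i ≤ n` (universal
  coefficients).

## References

* A. Hatcher, *Algebraic Topology*, CUP (2002), §4.3 Example 4.72, p. 408; §4.2 Thm. 4.41,
  p. 406; Thm. 4.32; §3.1 Thm. 3.2. [HatcherAT2002]
-/

noncomputable section

open Set Metric Function Topology CategoryTheory CategoryTheory.Limits
open scoped unitInterval Topology

namespace Literature.AlgebraicTopology.Homotopy

open Literature.AlgebraicTopology.SingularHomology

/-! ### Naturality of the connecting map -/

namespace IsSerreFibration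

variable {E B E' B' : Type*} [TopologicalSpace E] [TopologicalSpace B] [TopologicalSpace E']
  [TopologicalSpace B'] {p : E → B} {p' : E' → B'} {N : Type*} [DecidableEq N] [Fintype N]

/-- A fibrewise map sends the fibre through `x₀` into the fibre through `Φ x₀`. [folklore] -/
theorem mapsTo_fibre (Φ : C(E, E')) (g : C(B, B')) (hsq : ∀ x, p' (Φ x) = g (p x)) (x₀ : E) :
    MapsTo Φ (fibre p x₀) (fibre p' (Φ x₀)) := fun x hx => by
  change p' (Φ x) = p' (Φ x₀)
  rw [hsq, hsq, show p x = p x₀ from hx]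

/-- The restriction of a fibrewise map to the fibres through `x₀` and `Φ x₀`. [folklore] -/
abbrev fibreMap (Φ : C(E, E')) (g : C(B, B')) (hsq : ∀ x, p' (Φ x) = g (p x)) (x₀ : E) :
    C(↥(fibre p x₀), ↥(fibre p' (Φ x₀))) :=
  ⟨fun x => ⟨Φ x, mapsTo_fibre Φ g hsq x₀ x.2⟩, (Φ.continuous.comp continuous_subtype_val).subtype_mk _⟩

/-- **Naturality of the connecting map of the fibration sequence** (Hatcher 2002, Thm. 4.41 with
§4.1 p. 344: the long exact sequence is natural under maps of fibrations): for Serre fibrations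
`p`, `p'`, a fibrewise `Φ : E → E'` over `g : B → B'` and `β ∈ π_N(B, p x₀)`,
`∂' (g_* β) = (Φ|F)_* (∂ β)`. [cite: HatcherAT2002, §4.2 Thm. 4.41, §4.1 p. 344] -/
theorem delta_natural (h : IsSerreFibration p) (h' : IsSerreFibration p') (Φ : C(E, E')) (g : C(B, B'))
    (hsq : ∀ x, p' (Φ x) = g (p x)) (s : N) (x₀ : E) (β : HomotopyGroup N B (p x₀)) :
    delta h' s (Φ x₀) (homotopyGroupMapOfEq g (hsq x₀) β) =
      homotopyGroupMap (fibreMap Φ g hsq x₀) (fibreBase p x₀) (delta h s x₀ β) := by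
  obtain ⟨c, rfl⟩ := projRel_surjective h s x₀ β
  -- `g_* (p_* c) = p'_* (Φ_* c)`
  have h1 : homotopyGroupMapOfEq g (hsq x₀) (projRel h.continuous s x₀ c) =
      projRel h'.continuous s (Φ x₀)
        (RelHomotopyGroup.mapOfEq (i := s) (a := fibreBase p x₀) (b := fibreBase p' (Φ x₀)) Φ
          (mapsTo_fibre Φ g hsq x₀) rfl c) := by
    induction c using Quotient.inductionOn with
    | h q => exact congrArg (Quotient.mk _) (GenLoop.ext _ _ fun y => (hsq (q y)).symm)
  rw [h1, delta_projRel, delta_projRel,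
    RelHomotopyGroup.boundary_mapOfEq Φ (mapsTo_fibre Φ g hsq x₀) rfl (fibreMap Φ g hsq x₀) (fun _ => rfl),
    homotopyGroupMapOfEq_rfl]

end IsSerreFibration

/-! ### The cover of the sphere -/

namespace SphereCover

/-- Local notation: the unit sphere `𝕊 n ⊆ ℝⁿ⁺¹` (a set, used as a type). -/
local notation "𝕊 " n:arg => (Metric.sphere (0 : EuclideanSpace ℝ (Fin (n + 1))) 1)

/-- The second projection of the pullback, fibrewise over `ι`. [cite: HatcherAT2002, §4.2 p. 406] -/
abbrev sndMap (n : ℕ) [NeZero n] (v : 𝕊 n) : C(E n v, PathSpace (P n) (ι n v)) :=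
  ⟨IsHurewiczFibration.Pullback.snd, IsHurewiczFibration.Pullback.continuous_snd⟩

/-- The pullback square commutes: `endPt ∘ snd = ι ∘ proj`. [folklore] -/
theorem endPt_sndMap (n : ℕ) [NeZero n] (v : 𝕊 n) (z : E n v) :
    MappingPath.endPt (sndMap n v z) = ι n (proj n v z) := z.2.symm

/-- On the fibre over `v`, `snd` is the homeomorphism `fibHomeomorph` (between the same sets with
other names), hence bijective on homotopy groups. [folklore] -/
theorem bijective_homotopyGroupMap_fibreMap (n : ℕ) [NeZero n] (v : 𝕊 n) {M : Type*} [DecidableEq M] [Fintype M] :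
    Bijective (homotopyGroupMap (N := M)
      (IsSerreFibration.fibreMap (p := proj n v) (p' := MappingPath.endPt) (sndMap n v) (ι n) (endPt_sndMap n v)
        (fib₀ n v)) (fibreBase (proj n v) (fib₀ n v))) := by
  let e1 : ↥(fibre (proj n v) (fib₀ n v)) ≃ₜ Fib n v := Homeomorph.setCongr rfl
  let e3 : PathFibre.F (ι n v) (ι n v) ≃ₜ ↥(fibre (MappingPath.endPt : PathSpace (P n) (ι n v) → P n)
      (sndMap n v (fib₀ n v))) := Homeomorph.setCongr rfl
  let e : ↥(fibre (proj n v) (fib₀ n v)) ≃ₜ ↥(fibre (MappingPath.endPt : PathSpace (P n) (ι n v) → P n)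
      (sndMap n v (fib₀ n v))) := (e1.trans (fibHomeomorph n v)).trans e3
  have he : (IsSerreFibration.fibreMap (p := proj n v) (p' := MappingPath.endPt) (sndMap n v) (ι n)
      (endPt_sndMap n v) (fib₀ n v)) = (e : C(_, _)) := by
    ext z; rfl
  rw [he]
  exact bijective_homotopyGroupMap_homeomorph e _

/-- **The boundary map `∂ : πₘ₊₂(Sᵐ⁺², v) → πₘ₊₁(F, fib₀)` of the cover is bijective**: by
naturality it is the boundary isomorphism of the path fibration (Hatcher p. 408) composed with
`ι_* : πₙ(Sⁿ) ≅ πₙ(PₙSⁿ)` and the homeomorphism of fibres. [cite: HatcherAT2002, §4.3 Example 4.72, p. 408] -/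
theorem bijective_delta (m : ℕ) (v : 𝕊 (m + 2)) :
    Bijective (IsSerreFibration.delta (isSerreFibration_proj (m + 2) v) (0 : Fin (m + 2)) (fib₀ (m + 2) v)) := by
  haveI : Nonempty { j : Fin (m + 2) // j ≠ 0 } := ⟨⟨⟨1, by omega⟩, by simp⟩⟩
  have hnat := IsSerreFibration.delta_natural (isSerreFibration_proj (m + 2) v)
    (PathSpace.isSerreFibration_endPt (ι (m + 2) v)) (sndMap (m + 2) v) (ι (m + 2)) (endPt_sndMap (m + 2) v)
    (0 : Fin (m + 2)) (fib₀ (m + 2) v)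
  -- the path-fibration boundary map at `base (ι v) = snd fib₀` is bijective
  have hP : Bijective (IsSerreFibration.delta (PathSpace.isSerreFibration_endPt (ι (m + 2) v)) (0 : Fin (m + 2))
      (sndMap (m + 2) v (fib₀ (m + 2) v))) := PathSpace.bijective_delta 0 (ι (m + 2) v)
  -- `ι_*` is bijective on `πₙ`
  have hι : Bijective (homotopyGroupMapOfEq (N := Fin (m + 2)) (ι (m + 2)) (endPt_sndMap (m + 2) v (fib₀ (m + 2) v))) := by
    rw [show homotopyGroupMapOfEq (N := Fin (m + 2)) (ι (m + 2)) (endPt_sndMap (m + 2) v (fib₀ (m + 2) v)) =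
        homotopyGroupMap (ι (m + 2)) v from homotopyGroupMapOfEq_rfl _ _]
    exact bijective_homotopyGroupMap_ι (m + 2) le_rfl v
  have hF := bijective_homotopyGroupMap_fibreMap (m + 2) v (M := { j : Fin (m + 2) // j ≠ 0 })
  -- `F_* ∘ ∂ = ∂' ∘ ι_*` is bijective, and `F_*` is bijective
  have hcomp : Bijective ((homotopyGroupMap (N := { j : Fin (m + 2) // j ≠ 0 })
      (IsSerreFibration.fibreMap (p := proj (m + 2) v) (p' := MappingPath.endPt) (sndMap (m + 2) v) (ι (m + 2))
        (endPt_sndMap (m + 2) v) (fib₀ (m + 2) v)) (fibreBase (proj (m + 2) v) (fib₀ (m + 2) v))) ∘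
      IsSerreFibration.delta (isSerreFibration_proj (m + 2) v) (0 : Fin (m + 2)) (fib₀ (m + 2) v)) := by
    have heq : (homotopyGroupMap (N := { j : Fin (m + 2) // j ≠ 0 })
        (IsSerreFibration.fibreMap (p := proj (m + 2) v) (p' := MappingPath.endPt) (sndMap (m + 2) v) (ι (m + 2))
          (endPt_sndMap (m + 2) v) (fib₀ (m + 2) v)) (fibreBase (proj (m + 2) v) (fib₀ (m + 2) v))) ∘
        IsSerreFibration.delta (isSerreFibration_proj (m + 2) v) (0 : Fin (m + 2)) (fib₀ (m + 2) v) =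
        IsSerreFibration.delta (PathSpace.isSerreFibration_endPt (ι (m + 2) v)) (0 : Fin (m + 2))
          (sndMap (m + 2) v (fib₀ (m + 2) v)) ∘
        homotopyGroupMapOfEq (N := Fin (m + 2)) (ι (m + 2)) (endPt_sndMap (m + 2) v (fib₀ (m + 2) v)) :=
      funext fun β => (hnat β).symm
    rw [heq]
    exact hP.comp hι
  exact (Function.Bijective.of_comp_iff' hF _).1 hcomp

variable (n : ℕ) [NeZero n] (v : 𝕊 n)

/-- **`Sⁿ⟨n⟩` is path connected** (`n ≥ 2`): lift a path of the base from `proj z` to `v` starting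
at `z`, ending in the path-connected fibre. [cite: HatcherAT2002, §4.3 Example 4.72] -/
theorem pathConnectedSpace_E (hn : 2 ≤ n) : PathConnectedSpace (E n v) := by
  haveI := pathConnectedSpace_fib n v hn
  haveI : PathConnectedSpace (𝕊 n) := by
    rw [← isPathConnected_iff_pathConnectedSpace]
    exact isPathConnected_sphere (by
      rw [← Module.finrank_eq_rank]
      exact_mod_cast (show 1 < Module.finrank ℝ (EuclideanSpace ℝ (Fin (n + 1))) by
        rw [finrank_euclideanSpace_fin]; omega)) 0 zero_le_one
  have key : ∀ z : E n v, Joined z (fib₀ n v) := fun z => by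
    obtain ⟨γ⟩ := PathConnectedSpace.joined (proj n v z) v
    obtain ⟨Γ, hΓ0, hΓ⟩ := (isSerreFibration_proj n v).exists_path_lift (γ : C(I, 𝕊 n)) z γ.source.symm
    have h1 : Joined z (Γ 1) := ⟨⟨Γ, by simpa using hΓ0, rfl⟩⟩
    have hmem : Γ 1 ∈ (proj n v) ⁻¹' {v} := by
      change proj n v (Γ 1) = v
      rw [hΓ]; exact γ.target
    obtain ⟨δ⟩ := PathConnectedSpace.joined (⟨Γ 1, hmem⟩ : Fib n v) (fib₀ n v)
    exact h1.trans ⟨δ.map continuous_subtype_val⟩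
  exact ⟨⟨fib₀ n v⟩, fun z w => (key z).trans (key w).symm⟩

/-- **`πₖ(Sᵐ⁺²⟨m+2⟩, fib₀) = 0` for `1 ≤ k ≤ m + 2`** at the base point `fib₀` (long exact sequence:
`πₖ(F) = 0` for `k ≠ m + 1`, `πₖ(S) = 0` for `k ≤ m + 1`, and the bijective boundary map in
degree `m + 2`). [cite: HatcherAT2002, §4.3 Example 4.72] -/
theorem subsingleton_homotopyGroup_E_fib₀ (m : ℕ) (v : 𝕊 (m + 2)) {k : ℕ} (hk1 : 1 ≤ k) (hk : k ≤ m + 2) :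
    Subsingleton (π_ k (E (m + 2) v) (fib₀ (m + 2) v)) := by
  obtain ⟨k, rfl⟩ : ∃ k', k = k' + 1 := ⟨k - 1, by omega⟩
  have hS := isSerreFibration_proj (m + 2) v
  -- the fibre through `fib₀` is `Fib` (same set)
  have hfibF : ∀ {M : Type} [DecidableEq M] [Fintype M] (j : ℕ), Fintype.card M = j → 1 ≤ j → j ≠ m + 1 →
      Subsingleton (HomotopyGroup M ↥(fibre (proj (m + 2) v) (fib₀ (m + 2) v)) (fibreBase (proj (m + 2) v) (fib₀ (m + 2) v))) := by
    intro M _ _ j hj hj1 hjm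
    haveI := subsingleton_homotopyGroup_fib (m + 2) v (k := j) hj1 (by omega) (fib₀ (m + 2) v)
    have e : M ≃ Fin j := Fintype.equivFinOfCardEq hj
    exact (homotopyGroupCongr (X := Fib (m + 2) v) (x := fib₀ (m + 2) v) e).subsingleton
  refine ⟨fun a b => ?_⟩
  rcases Nat.lt_or_ge (k + 1) (m + 2) with hlt | hge
  · -- `π_{k+1}(S) = 0`: `a, b` come from the fibre
    haveI : Subsingleton (π_ (k + 1) (𝕊 (m + 2)) (proj (m + 2) v (fib₀ (m + 2) v))) :=
      subsingleton_homotopyGroup_sphere (by rw [finrank_euclideanSpace_fin]; omega) _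
    obtain ⟨c, rfl⟩ := hS.exists_homotopyGroupIncl_eq (0 : Fin (k + 1)) (fib₀ (m + 2) v) a (Subsingleton.elim _ _)
    obtain ⟨d, rfl⟩ := hS.exists_homotopyGroupIncl_eq (0 : Fin (k + 1)) (fib₀ (m + 2) v) b (Subsingleton.elim _ _)
    rcases eq_or_ne (k + 1) (m + 1) with hkm | hkm
    · -- `k = m`: the fibre classes are boundaries of classes of `π_{m+2}(S)`, which die in `E`
      have hk' : k = m := by omega
      subst hk'
      haveI : Nonempty { j : Fin (k + 2) // j ≠ 0 } := ⟨⟨⟨1, by omega⟩, by simp⟩⟩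
      let ιx : { j : Fin (k + 2) // j ≠ 0 } ≃ Fin (k + 1) :=
        { toFun := fun j => j.1.pred j.2
          invFun := fun i => ⟨i.succ, Fin.succ_ne_zero i⟩
          left_inv := fun j => Subtype.ext (Fin.succ_pred j.1 j.2)
          right_inv := fun i => Fin.pred_succ i }
      have hsurj := (bijective_delta k v).2
      have key : ∀ c' : HomotopyGroup { j : Fin (k + 2) // j ≠ 0 } ↥(fibre (proj (k + 2) v) (fib₀ (k + 2) v))
          (fibreBase (proj (k + 2) v) (fib₀ (k + 2) v)),
          homotopyGroupIncl (fibre (proj (k + 2) v) (fib₀ (k + 2) v)) (fibreBase (proj (k + 2) v) (fib₀ (k + 2) v)) c' =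
            ⟦GenLoop.const⟧ := fun c' => by
        obtain ⟨β, rfl⟩ := hsurj c'
        exact hS.homotopyGroupIncl_delta 0 (fib₀ (k + 2) v) β
      have key' : ∀ c' : HomotopyGroup (Fin (k + 1)) ↥(fibre (proj (k + 2) v) (fib₀ (k + 2) v))
          (fibreBase (proj (k + 2) v) (fib₀ (k + 2) v)),
          homotopyGroupIncl (fibre (proj (k + 2) v) (fib₀ (k + 2) v)) (fibreBase (proj (k + 2) v) (fib₀ (k + 2) v)) c' =
            ⟦GenLoop.const⟧ := fun c' => by
        obtain ⟨c'', rfl⟩ := (homotopyGroupCongr (X := ↥(fibre (proj (k + 2) v) (fib₀ (k + 2) v)))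
          (x := fibreBase (proj (k + 2) v) (fib₀ (k + 2) v)) ιx).surjective c'
        have h1 := homotopyGroupCongr_homotopyGroupMap ιx
          (⟨Subtype.val, continuous_subtype_val⟩ : C(↥(fibre (proj (k + 2) v) (fib₀ (k + 2) v)), E (k + 2) v)) c''
        change homotopyGroupMap _ _ (homotopyGroupCongr ιx c'') = _
        rw [← h1]
        change homotopyGroupCongr ιx (homotopyGroupIncl _ _ c'') = _
        rw [key c'', homotopyGroupCongr_mk]
        exact congrArg (Quotient.mk _) (GenLoop.ext _ _ fun _ => rfl)
      rw [key' c, key' d]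
    · haveI := hfibF (M := Fin (k + 1)) (k + 1) (Fintype.card_fin _) (by omega) hkm
      rw [Subsingleton.elim c d]
  · -- `k + 1 = m + 2`: `p_*` is injective on `π_{m+2}(E)` and its image dies under the injective `∂`
    have hk' : k = m + 1 := by omega
    subst hk'
    haveI : Nonempty { j : Fin (m + 1 + 1) // j ≠ 0 } := ⟨⟨⟨1, by omega⟩, by simp⟩⟩
    have hinj := (bijective_delta m v).1
    have hp0 : ∀ a' : π_ (m + 1 + 1) (E (m + 2) v) (fib₀ (m + 2) v),
        homotopyGroupMap ⟨proj (m + 2) v, hS.continuous⟩ (fib₀ (m + 2) v) a' = ⟦GenLoop.const⟧ := fun a' => by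
      apply hinj
      rw [hS.delta_homotopyGroupMap]
      exact (hS.delta_const 0 (fib₀ (m + 2) v)).symm
    obtain ⟨c, rfl⟩ := hS.exists_homotopyGroupIncl_eq (0 : Fin (m + 1 + 1)) (fib₀ (m + 2) v) a (hp0 a)
    obtain ⟨d, rfl⟩ := hS.exists_homotopyGroupIncl_eq (0 : Fin (m + 1 + 1)) (fib₀ (m + 2) v) b (hp0 b)
    haveI := hfibF (M := Fin (m + 1 + 1)) (m + 2) (Fintype.card_fin _) (by omega) (by omega)
    rw [Subsingleton.elim c d]

/-- **`πₖ(Sᵐ⁺²⟨m+2⟩) = 0` for `1 ≤ k ≤ m + 2` at every base point.** [cite: HatcherAT2002, §4.3 Example 4.72] -/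
theorem subsingleton_homotopyGroup_E (m : ℕ) (v : 𝕊 (m + 2)) {k : ℕ} (hk1 : 1 ≤ k) (hk : k ≤ m + 2)
    (z : E (m + 2) v) : Subsingleton (π_ k (E (m + 2) v) z) := by
  haveI := pathConnectedSpace_E (m + 2) v (by omega)
  exact subsingleton_homotopyGroup_of_pathConnectedSpace (subsingleton_homotopyGroup_E_fib₀ m v hk1 hk) z

/-- **`Sᵐ⁺²⟨m+2⟩` is simply connected.** [cite: HatcherAT2002, §4.3 Example 4.72] -/
theorem simplyConnectedSpace_E (m : ℕ) (v : 𝕊 (m + 2)) : SimplyConnectedSpace (E (m + 2) v) := by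
  haveI := pathConnectedSpace_E (m + 2) v (by omega)
  haveI : Subsingleton (π_ 1 (E (m + 2) v) (fib₀ (m + 2) v)) :=
    subsingleton_homotopyGroup_E_fib₀ m v le_rfl (by omega)
  haveI : Subsingleton (FundamentalGroup (E (m + 2) v) (fib₀ (m + 2) v)) :=
    (homotopyGroupEquivFundamentalGroupOfUnique (X := E (m + 2) v) (x := fib₀ (m + 2) v) (Fin 1)).symm.subsingleton
  exact Literature.AlgebraicTopology.FundamentalGroup.VanKampen.simplyConnectedSpace_of_subsingleton (fib₀ (m + 2) v)

/-- **`Hᵢ(Sᵐ⁺²⟨m+2⟩; ℤ) = 0` for `0 < i ≤ m + 2`** (Hurewicz, Thm. 4.32, on the `(m+2)`-connected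
cover). [cite: HatcherAT2002, Thm. 4.32, §4.3 Example 4.72] -/
theorem isZero_singularHomology_E (m : ℕ) (v : 𝕊 (m + 2)) {i : ℕ} (hi0 : 0 < i) (hi : i ≤ m + 2) :
    IsZero (singularHomology ℤ ℤ (E (m + 2) v) i) := by
  haveI := simplyConnectedSpace_E m v
  exact Literature.AlgebraicTopology.SingularHomology.hurewicz_isZero_holds (E (m + 2) v) (m + 3) (by omega)
    (fun k hk2 hk z => subsingleton_homotopyGroup_E m v (by omega) (by omega) z) i hi0 (by omega)

/-- **`Hⁱ(Sᵐ⁺²⟨m+2⟩; ℤ) = 0` for `1 ≤ i ≤ m + 2`** (universal coefficients: `Hᵢ₋₁` free — zero, or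
`H₀` of a path-connected space — and `Hᵢ = 0`). [cite: HatcherAT2002, §3.1 Thm. 3.2, Thm. 4.32] -/
theorem isZero_singularCohomology_E (m : ℕ) (v : 𝕊 (m + 2)) {i : ℕ} (hi1 : 1 ≤ i) (hi : i ≤ m + 2) :
    IsZero (singularCohomology ℤ ℤ (E (m + 2) v) i) := by
  obtain ⟨j, rfl⟩ : ∃ j, i = j + 1 := ⟨i - 1, by omega⟩
  haveI := pathConnectedSpace_E (m + 2) v (by omega)
  have hfree : Module.Free ℤ (singularHomology ℤ ℤ (E (m + 2) v) j) := by
    rcases Nat.eq_zero_or_pos j with rfl | hj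
    · exact free_singularHomology_zero
    · haveI : Subsingleton (singularHomology ℤ ℤ (E (m + 2) v) j) :=
        ModuleCat.subsingleton_of_isZero (isZero_singularHomology_E m v hj (by omega))
      infer_instance
  exact Literature.AlgebraicTopology.SingularHomology.isZero_singularCohomology_of_isZero_of_free
    (Literature.AlgebraicTopology.SingularHomology.injective_kroneckerMap_of_free_holds ℤ (E (m + 2) v) j) hfree
    (isZero_singularHomology_E m v (by omega) hi)

end SphereCover

end Literature.AlgebraicTopology.Homotopy

end
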